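import Summits.AtomisticToContinuum.BoseEinsteinCondensation.Theorems.BECConjugateDominationDefs
import Summits.AtomisticToContinuum.BoseEinsteinCondensation.Theorems.InfraredMinimumUncertainty.Negative.CellShiftToolkit
import Literature.MathematicalPhysics.QuantumManyBody.LangevinGenerator

/-!
# Route `BECConjugateDomination`, crux `InfraredMinimumUncertainty` (stmt-AtomisticToContinuum-11784),
# line `fisher-gaussian-density-mode`: the f-sum identity `Re ∫ Z̄_m W_m Ψ̄ = N‖k‖²`

Supports (does not close) stmt-AtomisticToContinuum-11784. This is the first closed rung of the gen-2
skeleton `Cruxes/InfraredMinimumUncertainty/Lines/fisher-gaussian-density-mode.lean`, made importable: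
calculus on the `N`-particle torus for the density mode `Z_m = ∑ⱼ e_m(xⱼ)` and the commutator
amplitude `W_m = ([H, ρ_k]Ψ)(X)` (objects of `BECConjugateDominationDefs.lean`):

* `fderiv_cellWave_comp_apply(_waveVec)`, `fderiv_densityMode_waveVec`: `∂_{x_j·k} e_m(x_l) = δ_{lj} i‖k‖² e_m(x_l)`,
  `∂_{x_j·k} Z_m = i‖k‖² e_m(x_j)`;
* `integral_cellN_fderiv_single_eq_zero`: directional periodic integration by parts
  `∫_{cell^N} ∂_{x_j·w} G = 0` (from `integral_cellN_pderiv_eq_zero` of `LangevinGenerator`);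
* `fsum_stepB`: the per-particle identity `∫ 2u ∂u · Im(Z̄eⱼ) = ‖k‖²∫u² − ‖k‖²∫u² Re(Z̄eⱼ)`;
* `fSumIdentity_holds`: **the f-sum identity** `Re ∫_{cell^N} Z̄_m W_m Ψ̄ = N‖k‖²` for every real-valued
  normalised periodic `C¹` state (`⟨ρ_k Ψ, [H, ρ_k]Ψ⟩ = ½⟨[ρ_k†, [H, ρ_k]]⟩ = N‖k‖²`, units `ħ = 2m = 1`).

It is the only input of the Cramér–Rao rung (IMU ⇒ FD ⇒ DMD, file `…Ladder.lean`); proofs: skeleton §FSum.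

References: Pines–Nozières, *The Theory of Quantum Liquids* I (1966) §2.4 (f-sum rule); Stringari 1995
§2.3 (20); Bakry–Gentil–Ledoux (2014) §1.11.3 (integration by parts).
-/

noncomputable section

open MeasureTheory Filter Set Metric
open scoped ENNReal NNReal Topology ComplexConjugate BigOperators

namespace Summit.AtomisticToContinuum.BoseEinsteinCondensation.Cruxes.InfraredMinimumUncertainty.FisherGaussianDensityMode

open Literature.MathematicalPhysics.QuantumManyBody.BoseGas
open Summit.AtomisticToContinuum.BoseEinsteinCondensation.Theorems.StaticResponseBound.Negative
  (integral_norm_sq_eq_one)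

section FSum

variable {N : ℕ}

/-- The density mode is continuous. -/
theorem continuous_densityMode (N : ℕ) (L : ℝ) (m : Fin 3 → ℤ) :
    Continuous (densityMode N L m) := by
  unfold densityMode
  exact continuous_finsetSum _ fun j _ =>
    (contDiff_cellWave L m).continuous.comp (continuous_apply j)

/-- The commutator amplitude of a `C¹` amplitude is continuous. -/
theorem continuous_commutatorAmp (N : ℕ) (L : ℝ) {ψ : Config N → ℂ} (hψ : ContDiff ℝ 1 ψ)
    (m : Fin 3 → ℤ) : Continuous (commutatorAmp N L ψ m) := by
  unfold commutatorAmp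
  refine continuous_finsetSum _ fun j _ => ?_
  refine ((contDiff_cellWave L m).continuous.comp (continuous_apply j)).mul ?_
  refine (continuous_const.mul hψ.continuous).sub (continuous_const.mul ?_)
  exact (hψ.continuous_fderiv one_ne_zero).clm_apply continuous_const

variable {N : ℕ}

/-- `‖k‖² = ∑_c (k c)²` -/
theorem norm_sq_waveVec (L : ℝ) (m : Fin 3 → ℤ) :
    ‖waveVec L m‖ ^ 2 = ∑ c : Fin 3, (waveVec L m c) ^ 2 := by
  rw [EuclideanSpace.norm_eq, Real.sq_sqrt (Finset.sum_nonneg fun c _ => by positivity)]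
  simp [Real.norm_eq_abs, sq_abs]

/-- the key arithmetic: `(2π i / L) · (∑_c m_c k_c) = i ‖k‖²` -/
theorem phase_factor_eq (L : ℝ) (m : Fin 3 → ℤ) :
    (2 * Real.pi * Complex.I / L) * ((∑ c : Fin 3, (m c : ℝ) * waveVec L m c : ℝ) : ℂ) =
      Complex.I * ((‖waveVec L m‖ ^ 2 : ℝ) : ℂ) := by
  rw [norm_sq_waveVec]
  simp_rw [waveVec_apply]
  push_cast
  simp_rw [Finset.mul_sum]
  refine Finset.sum_congr rfl fun c _ => ?_
  ring

/-- derivative of `X ↦ e_m(X l)` in the direction `Pi.single j w` -/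
theorem fderiv_cellWave_comp_apply (L : ℝ) (m : Fin 3 → ℤ) (l j : Fin N) (X : Config N) (w : Space) :
    fderiv ℝ (fun Y : Config N => cellWave L m (Y l)) X (Pi.single j w) =
      if l = j then cellWave L m (X l) * ((2 * Real.pi * Complex.I / L) *
        ((∑ c : Fin 3, (m c : ℝ) * w c : ℝ) : ℂ)) else 0 := by
  have h₀ := (hasFDerivAt_cellWave L m (X l)).comp X (hasFDerivAt_apply (𝕜 := ℝ) l X)
  have h : HasFDerivAt (fun Y : Config N => cellWave L m (Y l))
      ((cellWave L m (X l) • ((2 * Real.pi * Complex.I / L) •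
        (Complex.ofRealCLM.comp (∑ k : Fin 3, (m k : ℝ) • PiLp.proj (𝕜 := ℝ) 2 (fun _ : Fin 3 => ℝ) k)))).comp
        (ContinuousLinearMap.proj l)) X := h₀
  rw [h.fderiv, ContinuousLinearMap.comp_apply, ContinuousLinearMap.proj_apply, Pi.single_apply]
  split_ifs with hlj
  · subst hlj
    rw [FunLike.coe_smul, FunLike.coe_smul, Pi.smul_apply, Pi.smul_apply, ← sum_coord_eq_clm]
    simp only [smul_eq_mul]
  · simp

/-- derivative of `X ↦ e_m(X l)` along the density-wave direction `Pi.single j k` is `δ_{lj} i‖k‖² e_m(X l)` -/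
theorem fderiv_cellWave_comp_apply_waveVec (L : ℝ) (m : Fin 3 → ℤ) (l j : Fin N) (X : Config N) :
    fderiv ℝ (fun Y : Config N => cellWave L m (Y l)) X (Pi.single j (waveVec L m)) =
      if l = j then Complex.I * ((‖waveVec L m‖ ^ 2 : ℝ) : ℂ) * cellWave L m (X l) else 0 := by
  rw [fderiv_cellWave_comp_apply]
  split_ifs
  · rw [phase_factor_eq]; ring
  · rfl

/-- `Pi.single j w = ∑_c w_c • Pi.single j e_c` -/
theorem pi_single_eq_sum (j : Fin N) (w : Space) :
    (Pi.single j w : Config N) = ∑ c : Fin 3, w c • (Pi.single j (EuclideanSpace.single c (1 : ℝ)) : Config N) := by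
  have hw : w = ∑ c : Fin 3, w c • EuclideanSpace.single c (1 : ℝ) := by
    conv_lhs => rw [← (EuclideanSpace.basisFun (Fin 3) ℝ).sum_repr w]
    simp [EuclideanSpace.basisFun_apply]
  funext i
  rw [Finset.sum_apply]
  by_cases hij : i = j
  · subst hij
    simp only [Pi.single_eq_same, Pi.smul_apply]
    exact hw
  · simp [Pi.single_eq_of_ne hij]

/-- **directional periodic integration by parts**: `∫_{cell^N} ∂_{x_j · w} G = 0` -/
theorem integral_cellN_fderiv_single_eq_zero {L : ℝ} (hL : 0 < L) {G : Config N → ℝ}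
    (hG : ContDiff ℝ 1 G) (hper : IsLatticePeriodic L G) (j : Fin N) (w : Space) :
    ∫ X in cellN N L, fderiv ℝ G X (Pi.single j w) = 0 := by
  have hlin : ∀ X, fderiv ℝ G X (Pi.single j w) = ∑ c : Fin 3, w c * pderiv j c G X := by
    intro X
    rw [pi_single_eq_sum, map_sum]
    refine Finset.sum_congr rfl fun c _ => ?_
    rw [map_smul, smul_eq_mul, pderiv]
  simp_rw [hlin]
  rw [integral_finsetSum _ fun c _ => ((integrableOn_cellN (continuous_pderiv hG j c) L).const_mul _)]
  refine Finset.sum_eq_zero fun c _ => ?_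
  rw [integral_const_mul, integral_cellN_pderiv_eq_zero hL hG hper j c, mul_zero]
/-- `X ↦ e_m(X l)` is differentiable. -/
theorem differentiableAt_cellWave_comp_apply (L : ℝ) (m : Fin 3 → ℤ) (l : Fin N) (X : Config N) :
    DifferentiableAt ℝ (fun Y : Config N => cellWave L m (Y l)) X := by
  have h₀ := (hasFDerivAt_cellWave L m (X l)).comp X (hasFDerivAt_apply (𝕜 := ℝ) l X)
  exact h₀.differentiableAt

/-- `X ↦ e_m(X l)` is `C¹`. -/
theorem contDiff_cellWave_comp_apply (L : ℝ) (m : Fin 3 → ℤ) (l : Fin N) :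
    ContDiff ℝ 1 (fun Y : Config N => cellWave L m (Y l)) :=
  ((contDiff_cellWave L m).of_le (by exact_mod_cast le_top)).comp (contDiff_apply ℝ Space l)

/-- `∂_{x_j·k} Z = i‖k‖² e_j` -/
theorem fderiv_densityMode_waveVec (L : ℝ) (m : Fin 3 → ℤ) (j : Fin N) (X : Config N) :
    fderiv ℝ (densityMode N L m) X (Pi.single j (waveVec L m)) =
      Complex.I * ((‖waveVec L m‖ ^ 2 : ℝ) : ℂ) * cellWave L m (X j) := by
  have h₀ := HasFDerivAt.fun_sum (u := Finset.univ)
      (fun l _ => (differentiableAt_cellWave_comp_apply L m l X).hasFDerivAt)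
  have h : HasFDerivAt (densityMode N L m)
      (∑ l : Fin N, fderiv ℝ (fun Y : Config N => cellWave L m (Y l)) X) X := h₀
  rw [h.fderiv, FunLike.coe_sum, Finset.sum_apply]
  simp_rw [fderiv_cellWave_comp_apply_waveVec]
  simp [Finset.sum_ite_eq']

/-- The density mode is `C¹`. -/
theorem contDiff_densityMode (N : ℕ) (L : ℝ) (m : Fin 3 → ℤ) :
    ContDiff ℝ 1 (densityMode N L m) := by
  unfold densityMode
  exact ContDiff.sum fun l _ => contDiff_cellWave_comp_apply L m l

/-- the phase factor `F_j = Im(Z̄ e_j)` and its derivative along the density wave: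
`∂_{x_j·k} Im(Z̄ e_j) = ‖k‖² Re(Z̄ e_j) − ‖k‖²` -/
theorem fderiv_phaseIm_waveVec (L : ℝ) (m : Fin 3 → ℤ) (j : Fin N) (X : Config N) :
    fderiv ℝ (fun Y : Config N => (starRingEnd ℂ (densityMode N L m Y) * cellWave L m (Y j)).im) X
        (Pi.single j (waveVec L m)) =
      ‖waveVec L m‖ ^ 2 * (starRingEnd ℂ (densityMode N L m X) * cellWave L m (X j)).re -
        ‖waveVec L m‖ ^ 2 := by
  have hZ : HasFDerivAt (densityMode N L m) (fderiv ℝ (densityMode N L m) X) X :=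
    ((contDiff_densityMode N L m).differentiable one_ne_zero X).hasFDerivAt
  have hZc : HasFDerivAt (fun Y => star (densityMode N L m Y))
      (((starL' ℝ : ℂ ≃L[ℝ] ℂ) : ℂ →L[ℝ] ℂ).comp (fderiv ℝ (densityMode N L m) X)) X := hZ.star
  have he : HasFDerivAt (fun Y : Config N => cellWave L m (Y j))
      (fderiv ℝ (fun Y : Config N => cellWave L m (Y j)) X) X :=
    (differentiableAt_cellWave_comp_apply L m j X).hasFDerivAt
  have hprod := hZc.mul he
  have hF := (Complex.imCLM.hasFDerivAt.comp X hprod)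
  have hF' : HasFDerivAt (fun Y : Config N => (starRingEnd ℂ (densityMode N L m Y) * cellWave L m (Y j)).im)
      (Complex.imCLM.comp (star (densityMode N L m X) • fderiv ℝ (fun Y : Config N => cellWave L m (Y j)) X +
        cellWave L m (X j) • ((starL' ℝ : ℂ ≃L[ℝ] ℂ) : ℂ →L[ℝ] ℂ).comp (fderiv ℝ (densityMode N L m) X))) X :=
    hF
  rw [hF'.fderiv]
  simp only [ContinuousLinearMap.comp_apply, FunLike.coe_add, Pi.add_apply,
    FunLike.coe_smul, Pi.smul_apply, ContinuousLinearEquiv.coe_coe, starL'_apply,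
    Complex.star_def, smul_eq_mul, Complex.imCLM_apply]
  rw [fderiv_cellWave_comp_apply_waveVec, fderiv_densityMode_waveVec, if_pos rfl]
  have ht : cellWave L m (X j) * starRingEnd ℂ (cellWave L m (X j)) = 1 := by
    rw [mul_comm, ← Complex.normSq_eq_conj_mul_self, Complex.normSq_eq_norm_sq, norm_cellWave]
    simp
  have key : starRingEnd ℂ (densityMode N L m X) *
        (Complex.I * ((‖waveVec L m‖ ^ 2 : ℝ) : ℂ) * cellWave L m (X j)) +
      cellWave L m (X j) * starRingEnd ℂ (Complex.I * ((‖waveVec L m‖ ^ 2 : ℝ) : ℂ) * cellWave L m (X j)) =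
      Complex.I * ((‖waveVec L m‖ ^ 2 : ℝ) : ℂ) * (starRingEnd ℂ (densityMode N L m X) * cellWave L m (X j)) -
        Complex.I * ((‖waveVec L m‖ ^ 2 : ℝ) : ℂ) := by
    rw [map_mul, map_mul, Complex.conj_I, Complex.conj_ofReal]
    linear_combination (-(Complex.I * ((‖waveVec L m‖ ^ 2 : ℝ) : ℂ))) * ht
  rw [key]
  set κ : ℝ := ‖waveVec L m‖ ^ 2 with hκ
  simp only [Complex.sub_im, Complex.mul_im, Complex.mul_re, Complex.I_re, Complex.I_im,
    Complex.ofReal_re, Complex.ofReal_im, zero_mul, one_mul, mul_zero, sub_zero, zero_add]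

/-! ### periodicity helpers -/

/-- `X ↦ e_m(X l)` is lattice periodic in every particle. -/
theorem cellWave_comp_apply_periodic {L : ℝ} (hL : L ≠ 0) (m : Fin 3 → ℤ) (l : Fin N) (X : Config N)
    (i : Fin N) (c : Fin 3) :
    cellWave L m ((X + Pi.single i (EuclideanSpace.single c L) : Config N) l) = cellWave L m (X l) := by
  rw [Pi.add_apply]
  by_cases hli : l = i
  · subst hli
    rw [Pi.single_eq_same, cellWave_periodic hL]
  · rw [Pi.single_eq_of_ne hli, add_zero]

/-- The density mode is lattice periodic in every particle. -/
theorem densityMode_periodic {L : ℝ} (hL : L ≠ 0) (m : Fin 3 → ℤ) (X : Config N) (i : Fin N) (c : Fin 3) :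
    densityMode N L m (X + Pi.single i (EuclideanSpace.single c L)) = densityMode N L m X := by
  unfold densityMode
  exact Finset.sum_congr rfl fun l _ => cellWave_comp_apply_periodic hL m l X i c

/-! ### Step B -/

/-- The phase factor `Im(Z̄ e_j)` is `C¹`. -/
theorem contDiff_phaseIm (L : ℝ) (m : Fin 3 → ℤ) (j : Fin N) :
    ContDiff ℝ 1 (fun Y : Config N => (starRingEnd ℂ (densityMode N L m Y) * cellWave L m (Y j)).im) := by
  have h₀ := Complex.imCLM.contDiff.comp
    ((Complex.conjCLE.contDiff.comp (contDiff_densityMode N L m)).mul (contDiff_cellWave_comp_apply L m j))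
  exact h₀

/-- complex algebra of one summand of `Re(Z̄ W ū)` for a real amplitude -/
theorem re_summand (w : ℂ) (κ u u' : ℝ) :
    (w * (((κ : ℝ) : ℂ) * ((u : ℝ) : ℂ) - 2 * Complex.I * ((u' : ℝ) : ℂ)) * ((u : ℝ) : ℂ)).re =
      κ * u ^ 2 * w.re + 2 * u * u' * w.im := by
  simp only [Complex.mul_re, Complex.mul_im, Complex.sub_re, Complex.sub_im, Complex.ofReal_re,
    Complex.ofReal_im, Complex.I_re, Complex.I_im, Complex.re_ofNat, Complex.im_ofNat]
  ring

/-- **Step B** (per particle, periodic integration by parts along the density wave):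
`∫ 2 u ∂_{x_j·k}u · Im(Z̄ e_j) = ‖k‖² ∫ u² − ‖k‖² ∫ u² Re(Z̄ e_j)` for a real `C¹` lattice-periodic `u`. -/
theorem fsum_stepB {L : ℝ} (hL : 0 < L) (m : Fin 3 → ℤ) {u : Config N → ℝ} (hu : ContDiff ℝ 1 u)
    (hper : IsLatticePeriodic L u) (j : Fin N) :
    ∫ X in cellN N L, 2 * u X * fderiv ℝ u X (Pi.single j (waveVec L m)) *
        (starRingEnd ℂ (densityMode N L m X) * cellWave L m (X j)).im =
      (‖waveVec L m‖ ^ 2 * ∫ X in cellN N L, u X ^ 2) -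
        ‖waveVec L m‖ ^ 2 * ∫ X in cellN N L,
          u X ^ 2 * (starRingEnd ℂ (densityMode N L m X) * cellWave L m (X j)).re := by
  set κ : ℝ := ‖waveVec L m‖ ^ 2 with hκ
  set d : Config N := Pi.single j (waveVec L m) with hd
  set F : Config N → ℝ := fun Y => (starRingEnd ℂ (densityMode N L m Y) * cellWave L m (Y j)).im with hFdef
  set R : Config N → ℝ := fun Y => (starRingEnd ℂ (densityMode N L m Y) * cellWave L m (Y j)).re with hRdef
  have hF_cd : ContDiff ℝ 1 F := contDiff_phaseIm L m j
  have hu_d : Differentiable ℝ u := hu.differentiable one_ne_zero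
  -- the flux `G = u² F` is `C¹` and lattice periodic
  set G : Config N → ℝ := fun Y => u Y * u Y * F Y with hGdef
  have hG_cd : ContDiff ℝ 1 G := (hu.mul hu).mul hF_cd
  have hG_per : IsLatticePeriodic L G := by
    intro Y i c
    simp only [hGdef, hFdef, hper Y i c, densityMode_periodic hL.ne' m Y i c]
    rw [cellWave_comp_apply_periodic hL.ne' m j Y i c]
  -- its directional derivative
  have hderiv : ∀ X, fderiv ℝ G X d = u X ^ 2 * (κ * R X - κ) + 2 * u X * fderiv ℝ u X d * F X := by
    intro X
    have hu' : HasFDerivAt u (fderiv ℝ u X) X := (hu_d X).hasFDerivAt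
    have hF' : HasFDerivAt F (fderiv ℝ F X) X := (hF_cd.differentiable one_ne_zero X).hasFDerivAt
    have hG' : HasFDerivAt G _ X := (hu'.mul hu').mul hF'
    rw [hG'.fderiv]
    simp only [FunLike.coe_add, Pi.add_apply, FunLike.coe_smul, Pi.smul_apply,
      smul_eq_mul, Pi.mul_apply]
    rw [show fderiv ℝ F X d = κ * R X - κ from fderiv_phaseIm_waveVec L m j X]
    ring
  -- by parts
  have hbp : ∫ X in cellN N L, fderiv ℝ G X d = 0 :=
    integral_cellN_fderiv_single_eq_zero hL hG_cd hG_per j (waveVec L m)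
  simp_rw [hderiv] at hbp
  -- integrability of the pieces
  have hZc := continuous_densityMode N L m
  have hec : Continuous (fun Y : Config N => cellWave L m (Y j)) :=
    (contDiff_cellWave L m).continuous.comp (continuous_apply j)
  have hRc : Continuous R :=
    Complex.continuous_re.comp ((Complex.continuous_conj.comp hZc).mul hec)
  have hFc : Continuous F :=
    Complex.continuous_im.comp ((Complex.continuous_conj.comp hZc).mul hec)
  have huc : Continuous u := hu.continuous
  have hu'c : Continuous (fun Y => fderiv ℝ u Y d) := (hu.continuous_fderiv one_ne_zero).clm_apply continuous_const
  have hi1 : IntegrableOn (fun X => u X ^ 2 * (κ * R X - κ)) (cellN N L) volume :=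
    integrableOn_cellN ((huc.pow 2).mul ((continuous_const.mul hRc).sub continuous_const)) L
  have hi2 : IntegrableOn (fun X => 2 * u X * fderiv ℝ u X d * F X) (cellN N L) volume :=
    integrableOn_cellN (((continuous_const.mul huc).mul hu'c).mul hFc) L
  have hi3 : IntegrableOn (fun X => u X ^ 2) (cellN N L) volume := integrableOn_cellN (huc.pow 2) L
  have hi4 : IntegrableOn (fun X => u X ^ 2 * R X) (cellN N L) volume :=
    integrableOn_cellN ((huc.pow 2).mul hRc) L
  rw [integral_add hi1 hi2] at hbp
  have h1 : ∫ X in cellN N L, u X ^ 2 * (κ * R X - κ) =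
      (κ * ∫ X in cellN N L, u X ^ 2 * R X) - κ * ∫ X in cellN N L, u X ^ 2 := by
    have : ∀ X, u X ^ 2 * (κ * R X - κ) = κ * (u X ^ 2 * R X) - κ * u X ^ 2 := fun X => by ring
    simp_rw [this]
    rw [integral_sub (hi4.const_mul κ) (hi3.const_mul κ), integral_const_mul, integral_const_mul]
  rw [h1] at hbp
  linarith

/-! ### Assembly: the f-sum identity -/

/-- **The f-sum identity** `Re ∫ Z̄_m W_m Ψ̄ = N ‖k‖²` for a real-valued normalised periodic `C¹` state. -/
theorem fSumIdentity_holds : ∀ (n : ℕ) (L : ℝ), 0 < L → ∀ (Ψ : PeriodicTrialState (n + 1) L),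
    (∀ X, Ψ.ψ X = (‖Ψ.ψ X‖ : ℂ)) → ∀ (m : Fin 3 → ℤ),
    (∫ X in cellN (n + 1) L, (starRingEnd ℂ (densityMode (n + 1) L m X) *
        commutatorAmp (n + 1) L Ψ.ψ m X * starRingEnd ℂ (Ψ.ψ X)).re) =
      ((n : ℝ) + 1) * ‖waveVec L m‖ ^ 2 := by
  intro n L hL Ψ hreal m
  -- the real amplitude `u = Re Ψ = |Ψ|`
  set u : Config (n + 1) → ℝ := fun X => (Ψ.ψ X).re with hudef
  have hψu : ∀ X, Ψ.ψ X = ((u X : ℝ) : ℂ) := fun X => by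
    calc Ψ.ψ X = ((‖Ψ.ψ X‖ : ℝ) : ℂ) := hreal X
      _ = ((((‖Ψ.ψ X‖ : ℝ) : ℂ).re : ℝ) : ℂ) := by rw [Complex.ofReal_re]
      _ = ((u X : ℝ) : ℂ) := by rw [← hreal X]
  have hu_cd : ContDiff ℝ 1 u := by
    have h₀ := Complex.reCLM.contDiff.comp Ψ.contDiff
    exact h₀
  have hu_per : IsLatticePeriodic L u := fun X i c => by
    show (Ψ.ψ (X + Pi.single i (EuclideanSpace.single c L))).re = (Ψ.ψ X).re
    rw [Ψ.periodic X i c]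
  have hfun : Ψ.ψ = fun X => ((u X : ℝ) : ℂ) := funext hψu
  have hderiv : ∀ X (v : Config (n + 1)), fderiv ℝ Ψ.ψ X v = ((fderiv ℝ u X v : ℝ) : ℂ) := by
    intro X v
    have h₁ := Complex.ofRealCLM.hasFDerivAt.comp X ((hu_cd.differentiable one_ne_zero) X).hasFDerivAt
    have h₂ : HasFDerivAt Ψ.ψ (Complex.ofRealCLM.comp (fderiv ℝ u X)) X := by
      rw [hfun]; exact h₁
    rw [h₂.fderiv, ContinuousLinearMap.comp_apply, Complex.ofRealCLM_apply]
  set κ : ℝ := ‖waveVec L m‖ ^ 2 with hκ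
  -- pointwise expansion of the integrand
  set R : Fin (n + 1) → Config (n + 1) → ℝ := fun j X =>
    (starRingEnd ℂ (densityMode (n + 1) L m X) * cellWave L m (X j)).re with hRdef
  set F : Fin (n + 1) → Config (n + 1) → ℝ := fun j X =>
    (starRingEnd ℂ (densityMode (n + 1) L m X) * cellWave L m (X j)).im with hFdef
  set du : Fin (n + 1) → Config (n + 1) → ℝ := fun j X =>
    fderiv ℝ u X (Pi.single j (waveVec L m)) with hdudef
  have hpt : ∀ X, (starRingEnd ℂ (densityMode (n + 1) L m X) *
      commutatorAmp (n + 1) L Ψ.ψ m X * starRingEnd ℂ (Ψ.ψ X)).re =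
      ∑ j : Fin (n + 1), (κ * (u X ^ 2 * R j X) + 2 * u X * du j X * F j X) := by
    intro X
    have hW : commutatorAmp (n + 1) L Ψ.ψ m X = ∑ j : Fin (n + 1), cellWave L m (X j) *
        (((κ : ℝ) : ℂ) * ((u X : ℝ) : ℂ) - 2 * Complex.I * ((du j X : ℝ) : ℂ)) := by
      unfold commutatorAmp
      refine Finset.sum_congr rfl fun j _ => ?_
      rw [hderiv, ← hψu X]
    rw [hW, Finset.mul_sum, Finset.sum_mul, Complex.re_sum]
    refine Finset.sum_congr rfl fun j _ => ?_
    rw [hψu X, Complex.conj_ofReal]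
    have := re_summand (starRingEnd ℂ (densityMode (n + 1) L m X) * cellWave L m (X j)) κ (u X) (du j X)
    rw [show starRingEnd ℂ (densityMode (n + 1) L m X) *
        (cellWave L m (X j) * (((κ : ℝ) : ℂ) * ((u X : ℝ) : ℂ) - 2 * Complex.I * ((du j X : ℝ) : ℂ))) *
        ((u X : ℝ) : ℂ) =
      starRingEnd ℂ (densityMode (n + 1) L m X) * cellWave L m (X j) *
        (((κ : ℝ) : ℂ) * ((u X : ℝ) : ℂ) - 2 * Complex.I * ((du j X : ℝ) : ℂ)) * ((u X : ℝ) : ℂ) by ring]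
    rw [this]
    ring
  simp_rw [hpt]
  -- integrability and Step B per particle
  have hZc := continuous_densityMode (n + 1) L m
  have hec : ∀ j : Fin (n + 1), Continuous (fun Y : Config (n + 1) => cellWave L m (Y j)) := fun j =>
    (contDiff_cellWave L m).continuous.comp (continuous_apply j)
  have hRc : ∀ j, Continuous (R j) := fun j =>
    Complex.continuous_re.comp ((Complex.continuous_conj.comp hZc).mul (hec j))
  have hFc : ∀ j, Continuous (F j) := fun j =>
    Complex.continuous_im.comp ((Complex.continuous_conj.comp hZc).mul (hec j))
  have huc : Continuous u := hu_cd.continuous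
  have hduc : ∀ j, Continuous (du j) := fun j =>
    (hu_cd.continuous_fderiv one_ne_zero).clm_apply continuous_const
  have hiA : ∀ j, IntegrableOn (fun X => κ * (u X ^ 2 * R j X)) (cellN (n + 1) L) volume := fun j =>
    integrableOn_cellN (continuous_const.mul ((huc.pow 2).mul (hRc j))) L
  have hiB : ∀ j, IntegrableOn (fun X => 2 * u X * du j X * F j X) (cellN (n + 1) L) volume := fun j =>
    integrableOn_cellN (((continuous_const.mul huc).mul (hduc j)).mul (hFc j)) L
  have hiAB : ∀ j : Fin (n + 1),
      Integrable (fun X => κ * (u X ^ 2 * R j X) + 2 * u X * du j X * F j X)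
        (volume.restrict (cellN (n + 1) L)) := fun j => (hiA j).add (hiB j)
  rw [integral_finsetSum _ fun j _ => hiAB j]
  have hstep : ∀ j : Fin (n + 1), ∫ X in cellN (n + 1) L, (κ * (u X ^ 2 * R j X) + 2 * u X * du j X * F j X) =
      κ * ∫ X in cellN (n + 1) L, u X ^ 2 := by
    intro j
    rw [integral_add (hiA j) (hiB j), integral_const_mul]
    have hB := fsum_stepB hL m hu_cd hu_per j
    simp only [hdudef, hFdef, hRdef] at hB ⊢
    rw [hB]
    ring
  simp_rw [hstep]
  rw [Finset.sum_const, Finset.card_univ, Fintype.card_fin, nsmul_eq_mul]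
  -- `∫ u² = 1`
  have hnorm : ∫ X in cellN (n + 1) L, u X ^ 2 = 1 := by
    have h1 := integral_norm_sq_eq_one Ψ
    have : ∀ X, ‖Ψ.ψ X‖ ^ 2 = u X ^ 2 := fun X => by
      rw [hψu X, Complex.norm_real, Real.norm_eq_abs, sq_abs]
    simp_rw [this] at h1
    exact h1
  rw [hnorm]
  push_cast
  ring

end FSum

end Summit.AtomisticToContinuum.BoseEinsteinCondensation.Cruxes.InfraredMinimumUncertainty.FisherGaussianDensityMode

end
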